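import Literature.MathematicalPhysics.QuantumFieldTheory.Balaban1983to89.T4CondMeanChannel
import Literature.MathematicalPhysics.QuantumFieldTheory.Balaban1983to89.T4CovarianceResponse

/-!
# `Balaban1983to89.T4CondMeanChannelInsert` — the INSERT-LAW half of the two-law conditional-mean gap, BY NAME:
# ROUTE (R) the insert's first-order channel in the (β) currency (covariance response in the exterior, one reference
# exterior per law) and ROUTE (P) the PAIR RESPONSE at a fixed exterior (exponential interpolation old ↔ ins in the LAW);
# both ⇒ `CondMeanGap` ⇒ `|termDefect| ≤ ε·mass` ⇒ the per-step size of `DefectBoundedBy`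
# (cell T4, node O3b/H2 = NE1′, carved row T4-O3.E-NE1′-TEL-INS°; bookkeeping seam)

HONEST FRAMING.  Audit cell `pub-balaban`, unit `b2b-balaban-pv16-g12` (SURGE NODE PROVER #16, carved row
`T4-O3.E-NE1′-TEL-INS°` of `t4/T4-DAG.md` v17; companion record `HOME/t4/T4-EST-O3Ei1.md` §4i).  The cell's T4 target is
the existence and uniqueness of the continuum limit of unit-scale averaged loop expectations on a FINITE torus, with
Bałaban's densities as GIVEN data satisfying the printed end statement (B) as a HYPOTHESIS; it is NOT an infinite-volume
statement, NOT a mass gap, NOT the Clay problem, and this module is NOT progress on any summit.  Value = a kernel-checked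
SEAM and nothing more: the observable-level telescoping of unit `b2b-balaban-t4-ne1p-p3` needs, per ℝ-increment, the
two-law gap `T4ObservableTelescope.CondMeanGap s ins old g ε` («the conditional mean of the weight under the integrated
factor's fibre law vs under the INSERT's»); `T4CondMeanChannel` (this lineage, generation 11) discharged its LAW-(I) half
by the first-order channel and left the INSERT-LAW half as a slot (`abs_termDefect_le_of_suppression`, binder `hsup₂`)
with no supplier in the (β) currency and no conclusion named `CondMeanGap`; record `T4-EST-NE1p-P3.md` v3 (O1) lists the
insert-law half as «owner wanted».  This module supplies it, twice.  ROUTE (R) feeds the insert's conditional mean field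
through the SAME variance chain as law (I) (`T4CovarianceResponse.condMeanSuppression_of_varianceBound`, one reference
exterior per law).  ROUTE (P) compares the two conditional laws of one term DIRECTLY, as the endpoints of one exponential
interpolation IN THE LAW at a fixed exterior (`T4CovarianceResponse.norm_tiltMean_one_sub_zero_le` on a new path), with
no reference exterior, no `MeanVanishes` and no deviation-from-flatness functional.  Both end in `CondMeanGap` BY NAME,
hence in `|termDefect| ≤ ε·∫dV old` (`T4ObservableTelescope.abs_termDefect_le_of_condMeanGap`) and in the per-step size
of `T4ObservableTelescope.abs_defect_ropReal_le_sum` / `DefectBoundedBy` — the input of (W1)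
`T4ObservableTelescopeTwoRun.uniformGeomDefect_of_defectBoundedBy`.  NO size is asserted or proved for Bałaban's
densities: every variance bound, window agreement, domain cover, deviation cap and remainder is a binder (GAPS G-ne1p3-1
stays OPEN as to sizes; the K-uniform count and summation (W1) are unit t4-ne1p-p3's and are not touched here).

CITATION HEADER.  What is taken from T. Bałaban's series (CMP 1984–89) is ONLY what the imported tree modules already
quote and model, re-used BY NAME: the shape of one term of the large-field renormalization operation
[Balaban1989LargeFieldI] (0.3)–(0.4) p. 176 / (1.100)–(1.102) p. 201 as modelled by `T4DressedR.RopReal` /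
`B15.BasicStep.normTerm` / `fibreIntegral` / `integral_ropReal_eq` — «integrated large-field factor `ρ(Z,·)`» = `old`,
«inserted small-field expression `ρ(Z″,·)`» = `ins`, in the words of `T4DressedR` — with the proviso «the denominators
are positive» (`T4ObservableTelescope.TermProvisos.den_ne`); the conditional fibre law / mean
`T4DressingDefect.condLaw` / `condMean`; the linear part of an exponent term [Balaban1988RG2Cluster] (2.20) p. 16 as
typed by `T4FirstOrderSize.linTerm`; the exponential tilt, response domain and variance chain of `T4CovarianceResponse`.
No page of the series was newly read for this module; no sentence is newly attributed to it; the Gibbs form `χ·e^{h}` of a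
factor on a fibre is the tree's MODEL (`T4CovarianceResponse` §2), not a quotation, and nothing of Bałaban's averaging,
small-field densities, minimisers or R beyond the cited tree shapes is encoded (cell DIVERGENCE F6/F9 honoured).
ABSOLUTE RULE honoured: no programme-internal statement is a hypothesis-free input; every declaration is [folklore]
bookkeeping.

NEW vs PRINTED-TYPE (the row asks for it explicitly).
* PRINTED-TYPE (shapes the tree quotes from the series, re-used by name): the term structure and provisos of
  (0.3)/(1.100) (`RopReal`, `normTerm`, `TermProvisos`); in particular that the INSERT is live at every exterior
  (`den_ne`; here `liveSet_ins_eq_univ`) — the reason the insert half must be localised by the OLD term's live set.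
* CELL MODEL, typed EARLIER (not printed — Bałaban never compares conditional means; his R-invariance (0.4) is exact for
  undressed densities, `B15.BasicStep.integral_ropReal_eq`): the increment as «fibre mass × difference of the two
  conditional means» and the hypothesis shape `CondMeanGap` (`T4ObservableTelescope`, unit t4-ne1p-p3); the first-order
  channel and the `CondMeanSuppression` currency (`T4FirstOrderSize`, `T4CondMeanChannel`); the covariance response in
  the exterior with its (VAR) inputs (`T4CovarianceResponse`); cube-chart windows feeding `respDom`
  (`T4CubeChartTransport.mem_respDom_of_cubeChart`, unit pv28, real inserts).
* NEW HERE (kernel, [folklore]): (I1) the channel with the LAW and the LOCALISER decoupled; (I2)–(I4′) the insert-side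
  deviation and `CondMeanGap` with BOTH halves discharged, concluded BY NAME, the caps asked only on the old term's live
  set; (I5)–(I8) their (β)-currency instances for Gibbs laws, one reference exterior per law — (I6) with `w = ins`,
  `L = liveSet s old` IS the insert-law `CondMeanSuppression`-type channel the row asks for; (P1)–(P6) ROUTE (P): the law
  gap `lawGap`, the law path `lawPath` and its `TiltData`, the pair-response bound at one exterior in variance form
  (`√Vg·√VF`) and in oscillation form (`ε·2M` about a FREE fibre-independent constant — a fibre-independent part of
  `log(old/ins)` is invisible), the pair domain `pairDom`, the direct two-law channel of the linear part and of the full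
  weight (the reference `m V` CANCELS between the two laws); (S1) the step-level plug into `abs_defect_ropReal_le_sum`.

WHAT IS PROVED (all [folklore]; no `sorry`, no new axiom):
§1 `liveSet`, `liveSet_ins_eq_univ`; (I1) `condMean_channel_on`: `CondMeanSuppression dom (condMeanField s w Φ) S dev lip`,
   `L ⊆ dom`, `dev ≤ d` on `L`, `0 ≤ lip` ⇒ `∀ V ∈ L, |condMean s w (linDensity t S a Φ) V| ≤ |t|·(|S|·A·(lip·d))`.
§2 (I2) `insDev_of_channel` (the hypothesis `h₂` of `T4CondMeanChannel.condMeanGap_of_dev_at`, from a channel + a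
   remainder on any set where the law is live); (I3) `condMeanGap_of_insChannel`; (I4) `condMeanGap_of_suppression`:
   `CondMeanGap s ins old g ((p₁+q₁)+(p₂+q₂))`, `pᵢ = |t|·(|S|·A·(lipᵢ·dᵢ))`, from suppression data for BOTH laws'
   conditional mean fields; (I4′) `abs_termDefect_le_of_suppression_on`.
§3 ROUTE (R): (I5) `condMeanSuppression_reading_of_varianceBound`; (I6) `condMean_channel_of_varianceBound`
   (`p = |t|·(|S|·A·(σ·τ·d))` on any `L ⊆ respDom s χ h u₀ B S dev σ τ`); (I7) `condMeanGap_of_varianceBound` (both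
   halves, references `u₁` for `old = χ₁e^{h₁}`, `u₂` for `ins = χ₂e^{h₂}`); (I8) `abs_termDefect_le_of_varianceBound`.
§4 ROUTE (P): (P1) `fibreDensity_eq_expTilt_lawGap` (fibre-agreeing windows ⇒ `ins(V←·) = old(V←·)·e^{−lawGap}`),
   `condLaw_eq_lawPath_zero/one`, `lawPath_self`, `lawPathVar_self`, `tiltData_law`; (P2)
   `norm_condMean_pair_sub_le_of_varianceBound` (`‖∫F ∂condLaw s ins V − ∫F ∂condLaw s old V‖ ≤ √Vg·√VF`), (P2′)
   `norm_condMean_pair_sub_le_of_osc` (`≤ ε·(2M)`); (P3) `abs_condMean_linDensity_pair_le` (+ `linTerm_sub`); `pairDom`,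
   `mem_pairDom_self` (non-vacuity); (P4) `condMeanGap_linDensity_of_pairVariance`:
   `liveSet s old ⊆ pairDom … σ τ` ⇒ `CondMeanGap s ins old (linDensity t S a (fibreReading s B)) (|t|·(|S|·A·(σ·τ)))`;
   (P4′) `condMeanGap_linDensity_of_pairOsc`; (P5) `condMeanGap_of_pairChannel` (+ `condMean_sub_ref_eq`,
   `abs_condMean_rem_le`): `CondMeanGap s ins old g (p + (q₁+q₂))`; (P6) `abs_termDefect_le_of_pairVariance`;
   (S1) `abs_defect_ropReal_le_of_pairChannels`: `|∫(Σ_Z ρ(Z,·))·g − ∫(Rρ)·g| ≤ Σ_Z (p Z + (q₁ Z + q₂ Z))·∫dV ρ(Z,·)`.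

HONEST SCOPE / NOT PROVED.  (i) SIZES: the response moduli `σᵢ, τᵢ` / `σ, τ` — the (VAR) resp. (PVAR) inputs: uniform
variance bounds along the tilt resp. law path; for log-concave windows on a cube chart the Brascamp–Lieb chain of
`T4CubePoincare` / `T4CubeChartTransport` is the intended supplier (rows G7-BLCUBE* / G7-BLWINDOW°), NOT proved for
Bałaban's densities —, the deviation caps `dᵢ`, the amplitude `A` and weight `t` of the linearised dressing, the
remainders `q₁, q₂` (second-order channel, rows O3.E-iii): all binders.  (ii) COVERS: `liveSet s old ⊆ respDom …` (per
law) resp. `⊆ pairDom …` is the typed form of «wherever the integrated factor has mass, its exterior lies in the window /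
analyticity domain»; nothing about Bałaban's characteristic functions is asserted.  (iii) (WIN): ROUTE (P) needs the two
windows to AGREE on the fibre through every old-live exterior (`χ₂(V←y) = χ₁(V←y)`) — the regime in which the two factors
differ on the integrated variables only through their exponents; where the large-field window of `ρ(Z,·)` and the
small-field window of `ρ(Z″,·)` differ ON the fibre, route (P) does not apply as typed, and route (R) (or the zeroth-order
bound `T4ObservableTelescope.abs_termDefect_le_of_osc`) is the typed alternative.  (iv) GIBBS FORM: that the two factors
of a printed term are `χ·e^{h}` on the fibre with measurable bounded data is the tree's model of (1.100)–(1.102), an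
identification the cell has NOT certified page by page (record §4i).  (v) `MeanVanishes` at each reference exterior
(route (R); row O3.E-i′ (α)/K) is a binder; route (P) does not need it.  (vi) (W1): the K-uniform geometric decay of the
per-step sizes and the summation over terms and steps (`UniformGeomDefect`) are unit t4-ne1p-p3's
(`T4ObservableTelescopeTwoRun`); this module stops at the per-step size (S1).  (vii) Complex loop parameters, the (2.18)
format and the two-run matching are outside this module.
-/

noncomputable section

open _root_.MeasureTheory
open Function (updateFinset)
open scoped BigOperators InnerProductSpace ENNReal

namespace Literature.MathematicalPhysics.QuantumFieldTheory.Balaban1983to89.T4CondMeanChannelInsert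

open B15.BasicStep T4DressedR T4DressingDefect T4FirstOrderSize T4TiltModulus T4CondLawRelative T4ObservableTelescope
  T4CondMeanChannel T4CovarianceResponse

section Fibre

variable {P : Params} {j : ℕ} {G : Type*} [GaugeGroup G] [MeasurableSpace G] [HaarData G]
variable [DecidableEq (PBond P j)]
variable {β : Type*} {E : Type*} [NormedAddCommGroup E] [InnerProductSpace ℝ E]

/-! ## §1  The live set of a density and the first-order channel on a PRESCRIBED set of exteriors -/

/-- THE LIVE SET of a density `w` over the fibre `s`: the exterior fields through which `w` has fibre mass,
`{V | ∫dV⌈_s w (V) ≠ 0}` — the set on which `T4ObservableTelescope.CondMeanGap s ins old g ε` is demanded (for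
`w = old`) and on which the conditional law `condLaw s w V` is a probability measure. [folklore] -/
abbrev liveSet (s : Finset (PBond P j)) (w : Density P j G) : Set (GaugeField P j G) := {V | fibreIntegral s w V ≠ 0}

/-- Unfolding lemma. [folklore] -/
theorem mem_liveSet {s : Finset (PBond P j)} {w : Density P j G} {V : GaugeField P j G} :
    V ∈ liveSet s w ↔ fibreIntegral s w V ≠ 0 := Iff.rfl

/-- Under the printed provisos of one term («the denominators are positive») the INSERT is live at EVERY exterior —
which is why the insert-law half of the two-law gap must be localised by the OLD term's live set and not by its own
(`T4CondMeanChannel.condMeanGap_of_dev_at` vs. `T4ObservableTelescope.condMeanGap_of_dev`). [folklore] -/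
theorem liveSet_ins_eq_univ {s : Finset (PBond P j)} {ins old : Density P j G} {C : ℝ} (hP : TermProvisos s ins old C) :
    liveSet s ins = Set.univ :=
  Set.eq_univ_of_forall fun V => hP.den_ne V

/-- **(I1) THE FIRST-ORDER CHANNEL ON A PRESCRIBED SET OF EXTERIORS.**  For a law `w ≤ C`, a bond-insert field `Φ`
(strongly measurable bounded components on `S`), amplitudes `‖a b‖ ≤ A`, a suppression datum
`CondMeanSuppression dom (condMeanField s w Φ) S dev lip` and ANY set of exteriors `L ⊆ dom` on which the deviation is
capped by `d` (`0 ≤ lip`): `∀ V ∈ L, |condMean s w (linDensity t S a Φ) V| ≤ |t|·(|S|·A·(lip·d))`.  The law `w` under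
which the conditional mean is taken and the set `L` on which the bound is demanded are DECOUPLED: for `L = liveSet s w`
this is `T4CondMeanChannel.condMean_channel_of_suppression` (the `hp` channel of law (I)); for `w = ins`,
`L = liveSet s old` it is the INSERT-LAW channel the two-law gap needs. [folklore] -/
theorem condMean_channel_on [CompleteSpace E] (s : Finset (PBond P j)) {w : Density P j G} {C : ℝ}
    (hC : ∀ U, w U ≤ C) (t : ℝ) {S : Finset β} {a : β → E} {A : ℝ} (hA : ∀ b ∈ S, ‖a b‖ ≤ A)
    {Φ : GaugeField P j G → β → E} (hΦ : ∀ b ∈ S, StronglyMeasurable fun U => Φ U b) {R : ℝ}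
    (hR : ∀ b ∈ S, ∀ U, ‖Φ U b‖ ≤ R) {dom : Set (GaugeField P j G)} {dev : GaugeField P j G → ℝ} {lip : ℝ}
    (hsup : CondMeanSuppression dom (condMeanField s w Φ) S dev lip) {L : Set (GaugeField P j G)} (hdom : L ⊆ dom)
    {d : ℝ} (hdev : ∀ V ∈ L, dev V ≤ d) (hlip : 0 ≤ lip) :
    ∀ V ∈ L, |condMean s w (linDensity t S a Φ) V| ≤ |t| * ((S.card : ℝ) * A * (lip * d)) := by
  intro V hV
  refine (abs_condMean_linDensity_le s hC t hA hΦ hR hsup (hdom hV)).trans ?_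
  exact mul_le_mul_of_nonneg_left
    (mul_le_mul_of_nonneg_left (mul_le_mul_of_nonneg_left (hdev V hV) hlip) (card_mul_nonneg_of_amplitude hA))
    (abs_nonneg t)

/-! ## §2  The insert-side deviation and the two-law gap with BOTH halves discharged, by name -/

/-- **(I2) THE INSERT-SIDE DEVIATION ON A PRESCRIBED SET.**  For a law `ins` (measurable, `≤ C`) live on `L`, a bounded
measurable weight `g`, a bounded measurable fibre-independent reference `m`, a bounded measurable linear part `ℓ` whose
conditional mean under `ins` is `≤ p` on `L`, and a remainder bound `|g(V←y) − m V − ℓ(V←y)| ≤ q` on the support of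
`ins(V←·)` for `V ∈ L`: `∀ V ∈ L, |E^{ins}_s[g | V_out] − m V| ≤ p + q` — `T4CondMeanChannel.abs_condMean_sub_le_of_channels_at`
at every point of `L`.  With `L = liveSet s old` this is LITERALLY the hypothesis `h₂` of
`T4CondMeanChannel.condMeanGap_of_dev_at`. [folklore] -/
theorem insDev_of_channel (s : Finset (PBond P j)) {ins : Density P j G} (hm : Measurable ins) {C : ℝ}
    (hC : ∀ U, ins U ≤ C) {g m ℓ : Density P j G} (hg : Measurable g) (hmm : Measurable m) (hℓ : Measurable ℓ)
    {Bg Bm Bℓ : ℝ} (hBg : ∀ U, |g U| ≤ Bg) (hBm : ∀ U, |m U| ≤ Bm) (hBℓ : ∀ U, |ℓ U| ≤ Bℓ) (hmI : FibreIndep s m)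
    {L : Set (GaugeField P j G)} (hden : ∀ V ∈ L, fibreIntegral s ins V ≠ 0) {p q : ℝ}
    (hp : ∀ V ∈ L, |condMean s ins ℓ V| ≤ p)
    (hq : ∀ V ∈ L, ∀ y : s → G, ins (updateFinset V s y) ≠ 0 →
      |g (updateFinset V s y) - m V - ℓ (updateFinset V s y)| ≤ q) :
    ∀ V ∈ L, |condMean s ins g V - m V| ≤ p + q := fun V hV =>
  abs_condMean_sub_le_of_channels_at s hm hC hg hmm hℓ hBg hBm hBℓ hmI (hden V hV) (hp V hV) (hq V hV)

/-- **(I3) THE TWO-LAW GAP FROM A LAW-(I) DEVIATION AND AN INSERT-LAW CHANNEL.**  Under the printed provisos of one term,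
a one-law deviation `CondMeanDev s old g m ε₁`, an insert-law channel `|E^{ins}_s[ℓ | V_out]| ≤ p` ON THE OLD TERM'S LIVE
SET and the insert-side remainder `q` there give `CondMeanGap s ins old g (ε₁ + (p + q))` — (I2) fed into
`T4CondMeanChannel.condMeanGap_of_dev_at`; the insert's own liveness is the proviso `TermProvisos.den_ne`. [folklore] -/
theorem condMeanGap_of_insChannel {s : Finset (PBond P j)} {ins old : Density P j G} {C : ℝ}
    (hP : TermProvisos s ins old C) {g m ℓ : Density P j G} (hg : Measurable g) (hmm : Measurable m)
    (hℓ : Measurable ℓ) {Bg Bm Bℓ : ℝ} (hBg : ∀ U, |g U| ≤ Bg) (hBm : ∀ U, |m U| ≤ Bm) (hBℓ : ∀ U, |ℓ U| ≤ Bℓ)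
    (hmI : FibreIndep s m) {ε₁ p q : ℝ} (h₁ : CondMeanDev s old g m ε₁)
    (hp : ∀ V ∈ liveSet s old, |condMean s ins ℓ V| ≤ p)
    (hq : ∀ V ∈ liveSet s old, ∀ y : s → G, ins (updateFinset V s y) ≠ 0 →
      |g (updateFinset V s y) - m V - ℓ (updateFinset V s y)| ≤ q) :
    CondMeanGap s ins old g (ε₁ + (p + q)) :=
  condMeanGap_of_dev_at h₁
    (insDev_of_channel s hP.ins_meas hP.ins_le hg hmm hℓ hBg hBm hBℓ hmI (fun V _ => hP.den_ne V) hp hq)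

/-- **(I4) `CondMeanGap` WITH BOTH HALVES DISCHARGED BY SUPPRESSION DATA, BY NAME.**  Under `TermProvisos s ins old C`,
for a bounded measurable weight `g`, a bounded measurable fibre-independent reference `m`, the linear density of a
bond-insert field `Φ` as linear part, suppression data for the LAW-(I) conditional mean field (`dom₁, dev₁, lip₁`) AND
for the INSERT's (`dom₂, dev₂, lip₂`), both domains covering the OLD term's live set, caps `d₁`, `d₂` of the deviations
THERE, and remainder bounds `q₁` (support of `old(V←·)`) / `q₂` (support of `ins(V←·)` at old-live `V`):
`CondMeanGap s ins old g ((p₁ + q₁) + (p₂ + q₂))`, `pᵢ = |t|·(|S|·A·(lipᵢ·dᵢ))`.  Compared with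
`T4CondMeanChannel.abs_termDefect_le_of_suppression` (which goes straight to `|termDefect|` and caps the deviations on
the whole domains) the conclusion is the lane's hypothesis shape ITSELF and the caps are asked only where the gap is
demanded. [folklore] -/
theorem condMeanGap_of_suppression [CompleteSpace E] {s : Finset (PBond P j)} {ins old : Density P j G} {C : ℝ}
    (hP : TermProvisos s ins old C) {g : Density P j G} (hg : Measurable g) {Bg : ℝ} (hBg : ∀ U, |g U| ≤ Bg)
    {m : Density P j G} (hmm : Measurable m) {Bm : ℝ} (hBm : ∀ U, |m U| ≤ Bm) (hmI : FibreIndep s m) (t : ℝ)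
    {S : Finset β} {a : β → E} {A : ℝ} (hA : ∀ b ∈ S, ‖a b‖ ≤ A) {Φ : GaugeField P j G → β → E}
    (hΦ : ∀ b ∈ S, StronglyMeasurable fun U => Φ U b) {R : ℝ} (hR : ∀ b ∈ S, ∀ U, ‖Φ U b‖ ≤ R)
    {dom₁ dom₂ : Set (GaugeField P j G)} {dev₁ dev₂ : GaugeField P j G → ℝ} {lip₁ lip₂ d₁ d₂ q₁ q₂ : ℝ}
    (hsup₁ : CondMeanSuppression dom₁ (condMeanField s old Φ) S dev₁ lip₁)
    (hsup₂ : CondMeanSuppression dom₂ (condMeanField s ins Φ) S dev₂ lip₂) (hdom₁ : liveSet s old ⊆ dom₁)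
    (hdom₂ : liveSet s old ⊆ dom₂) (hdev₁ : ∀ V ∈ liveSet s old, dev₁ V ≤ d₁)
    (hdev₂ : ∀ V ∈ liveSet s old, dev₂ V ≤ d₂) (hlip₁ : 0 ≤ lip₁) (hlip₂ : 0 ≤ lip₂)
    (hq₁ : ∀ (V : GaugeField P j G) (y : s → G), old (updateFinset V s y) ≠ 0 →
      |g (updateFinset V s y) - m V - linDensity t S a Φ (updateFinset V s y)| ≤ q₁)
    (hq₂ : ∀ V ∈ liveSet s old, ∀ y : s → G, ins (updateFinset V s y) ≠ 0 →
      |g (updateFinset V s y) - m V - linDensity t S a Φ (updateFinset V s y)| ≤ q₂) :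
    CondMeanGap s ins old g
      ((|t| * ((S.card : ℝ) * A * (lip₁ * d₁)) + q₁) + (|t| * ((S.card : ℝ) * A * (lip₂ * d₂)) + q₂)) :=
  condMeanGap_of_insChannel hP hg hmm (measurable_linDensity t a hΦ) hBg hBm (abs_linDensity_le hA hR) hmI
    (condMeanDev_of_channels s hP.old_meas hP.old_le hg hmm (measurable_linDensity t a hΦ) hBg hBm
      (abs_linDensity_le hA hR) hmI (condMean_channel_on s hP.old_le t hA hΦ hR hsup₁ hdom₁ hdev₁ hlip₁) hq₁)
    (condMean_channel_on s hP.ins_le t hA hΦ hR hsup₂ hdom₂ hdev₂ hlip₂) hq₂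

/-- (I4′) … hence the increment bound `|termDefect s ins old g| ≤ ((p₁ + q₁) + (p₂ + q₂))·∫dV old` for a nonnegative
weight, by `T4ObservableTelescope.abs_termDefect_le_of_condMeanGap` — the statement of
`T4CondMeanChannel.abs_termDefect_le_of_suppression` with the caps localised. [folklore] -/
theorem abs_termDefect_le_of_suppression_on [CompleteSpace E] {s : Finset (PBond P j)} {ins old : Density P j G}
    {C : ℝ} (hP : TermProvisos s ins old C) {g : Density P j G} (hg : Measurable g) (hg0 : ∀ U, 0 ≤ g U) {Bg : ℝ}
    (hgB : ∀ U, g U ≤ Bg) {m : Density P j G} (hmm : Measurable m) {Bm : ℝ} (hBm : ∀ U, |m U| ≤ Bm)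
    (hmI : FibreIndep s m) (t : ℝ) {S : Finset β} {a : β → E} {A : ℝ} (hA : ∀ b ∈ S, ‖a b‖ ≤ A)
    {Φ : GaugeField P j G → β → E} (hΦ : ∀ b ∈ S, StronglyMeasurable fun U => Φ U b) {R : ℝ}
    (hR : ∀ b ∈ S, ∀ U, ‖Φ U b‖ ≤ R) {dom₁ dom₂ : Set (GaugeField P j G)} {dev₁ dev₂ : GaugeField P j G → ℝ}
    {lip₁ lip₂ d₁ d₂ q₁ q₂ : ℝ} (hsup₁ : CondMeanSuppression dom₁ (condMeanField s old Φ) S dev₁ lip₁)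
    (hsup₂ : CondMeanSuppression dom₂ (condMeanField s ins Φ) S dev₂ lip₂) (hdom₁ : liveSet s old ⊆ dom₁)
    (hdom₂ : liveSet s old ⊆ dom₂) (hdev₁ : ∀ V ∈ liveSet s old, dev₁ V ≤ d₁)
    (hdev₂ : ∀ V ∈ liveSet s old, dev₂ V ≤ d₂) (hlip₁ : 0 ≤ lip₁) (hlip₂ : 0 ≤ lip₂)
    (hq₁ : ∀ (V : GaugeField P j G) (y : s → G), old (updateFinset V s y) ≠ 0 →
      |g (updateFinset V s y) - m V - linDensity t S a Φ (updateFinset V s y)| ≤ q₁)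
    (hq₂ : ∀ V ∈ liveSet s old, ∀ y : s → G, ins (updateFinset V s y) ≠ 0 →
      |g (updateFinset V s y) - m V - linDensity t S a Φ (updateFinset V s y)| ≤ q₂) :
    |termDefect s ins old g|
      ≤ ((|t| * ((S.card : ℝ) * A * (lip₁ * d₁)) + q₁) + (|t| * ((S.card : ℝ) * A * (lip₂ * d₂)) + q₂))
        * ∫ V, old V ∂fieldMeasure P j G :=
  abs_termDefect_le_of_condMeanGap hP hg hg0 hgB
    (condMeanGap_of_suppression hP hg (fun U => by rw [abs_of_nonneg (hg0 U)]; exact hgB U) hmm hBm hmI t hA hΦ hR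
      hsup₁ hsup₂ hdom₁ hdom₂ hdev₁ hdev₂ hlip₁ hlip₂ hq₁ hq₂)

/-! ## §3  ROUTE (R) — the (β) currency BY NAME: the insert-law channel from the COVARIANCE RESPONSE in the exterior
(two reference exteriors, one per law; `T4CovarianceResponse.condMeanSuppression_of_varianceBound`) -/

/-- **(I5) THE RESPONSE-DOMAIN SUPPRESSION DATUM IN THE CHANNEL'S FORMAT.**  For a Gibbs law `w = χ·e^{h}` (`χ, h`
measurable, `0 ≤ χ`, `w ≤ C`) live at the reference exterior `u₀`, bond inserts `B` a.e.-strongly measurable and bounded on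
`S`, response moduli `σ, τ ≥ 0` and `MeanVanishes` of the fibre means at `u₀`:
`CondMeanSuppression (respDom s χ h u₀ B S dev σ τ) (condMeanField s w (fibreReading s B)) S dev (σ·τ)` —
`T4CovarianceResponse.condMeanSuppression_of_varianceBound` read through `T4CondMeanChannel.condMeanField_fibreReading`.
It applies verbatim to `w = old` (law (I)) and to `w = ins` (the insert law). [folklore] -/
theorem condMeanSuppression_reading_of_varianceBound [CompleteSpace E] (s : Finset (PBond P j)) {χ h : Density P j G}
    (hχm : Measurable χ) (hhm : Measurable h) (hχ0 : ∀ U, 0 ≤ χ U) {C : ℝ} (hC : ∀ U, χ U * Real.exp (h U) ≤ C)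
    {u₀ : GaugeField P j G} (hne : fibreIntegral s (fun U => χ U * Real.exp (h U)) u₀ ≠ 0) {B : (s → G) → β → E}
    {S : Finset β} (hB : ∀ b ∈ S, AEStronglyMeasurable (fun y => B y b) (fibreBase s)) {R : ℝ}
    (hR : ∀ b ∈ S, ∀ y, ‖B y b‖ ≤ R) {dev : GaugeField P j G → ℝ} {σ τ : ℝ} (hσ : 0 ≤ σ) (hτ : 0 ≤ τ)
    (hflat : MeanVanishes S fun b => ∫ y, B y b ∂condLaw s (fun U => χ U * Real.exp (h U)) u₀) :
    CondMeanSuppression (respDom s χ h u₀ B S dev σ τ)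
      (condMeanField s (fun U => χ U * Real.exp (h U)) (fibreReading s B)) S dev (σ * τ) := by
  intro u hu b hb
  rw [condMeanField_fibreReading]
  exact condMeanSuppression_of_varianceBound s hχm hhm hχ0 hC hne hB hR hσ hτ hflat u hu b hb

/-- **(I6) THE CHANNEL IN THE (β) CURRENCY ON A PRESCRIBED SET.**  Same Gibbs data; `L` any set of exteriors inside the
response domain of `w` relative to `u₀` on which `dev ≤ d`: `∀ V ∈ L, |E^{w}_s[linDensity t S a (fibreReading s B) | V_out]|
≤ |t|·(|S|·A·(σ·τ·d))` — (I1) ∘ (I5).  For `w = ins`, `L = liveSet s old` this is the INSERT-LAW CHANNEL of the carved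
row; for `w = old`, `L = liveSet s old` the law-(I) channel in the same currency.  No exponential of any oscillation, no
ceiling. [folklore] -/
theorem condMean_channel_of_varianceBound [CompleteSpace E] (s : Finset (PBond P j)) {χ h : Density P j G}
    (hχm : Measurable χ) (hhm : Measurable h) (hχ0 : ∀ U, 0 ≤ χ U) {C : ℝ} (hC : ∀ U, χ U * Real.exp (h U) ≤ C)
    {u₀ : GaugeField P j G} (hne : fibreIntegral s (fun U => χ U * Real.exp (h U)) u₀ ≠ 0) {B : (s → G) → β → E}
    {S : Finset β} (hB : ∀ b ∈ S, StronglyMeasurable fun y => B y b) {R : ℝ} (hR : ∀ b ∈ S, ∀ y, ‖B y b‖ ≤ R)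
    {dev : GaugeField P j G → ℝ} {σ τ : ℝ} (hσ : 0 ≤ σ) (hτ : 0 ≤ τ)
    (hflat : MeanVanishes S fun b => ∫ y, B y b ∂condLaw s (fun U => χ U * Real.exp (h U)) u₀)
    {L : Set (GaugeField P j G)} (hdom : L ⊆ respDom s χ h u₀ B S dev σ τ) {d : ℝ} (hdev : ∀ V ∈ L, dev V ≤ d)
    (t : ℝ) {a : β → E} {A : ℝ} (hA : ∀ b ∈ S, ‖a b‖ ≤ A) :
    ∀ V ∈ L, |condMean s (fun U => χ U * Real.exp (h U)) (linDensity t S a (fibreReading s B)) V|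
      ≤ |t| * ((S.card : ℝ) * A * (σ * τ * d)) :=
  condMean_channel_on s hC t hA (fun b hb => stronglyMeasurable_fibreReading s (hB b hb))
    (fun b hb U => hR b hb (onFibre s U))
    (condMeanSuppression_reading_of_varianceBound s hχm hhm hχ0 hC hne (fun b hb => (hB b hb).aestronglyMeasurable)
      hR hσ hτ hflat) hdom hdev (mul_nonneg hσ hτ)

/-- **(I7) `CondMeanGap` END TO END IN THE (β) CURRENCY, BOTH HALVES.**  One term with Gibbs laws `old = χ₁·e^{h₁}`
(law (I)) and `ins = χ₂·e^{h₂}` (the insert law) under the printed provisos; a reference exterior `u₁` live for `old`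
and ANY reference exterior `u₂` for `ins` (live by `den_ne`); bond inserts `B` strongly measurable and bounded on `S`
with `MeanVanishes` of the fibre means under `condLaw s old u₁` AND under `condLaw s ins u₂` (the (α)-node datum, once per
law); the OLD term's live set inside BOTH response domains (`respDom s χ₁ h₁ u₁ B S dev₁ σ₁ τ₁`,
`respDom s χ₂ h₂ u₂ B S dev₂ σ₂ τ₂` — the (VAR) inputs of `T4CovarianceResponse`, per law) with caps `devᵢ ≤ dᵢ` there;
remainder bounds `q₁`, `q₂`: `CondMeanGap s ins old g ((|t|·(|S|·A·(σ₁τ₁·d₁)) + q₁) + (|t|·(|S|·A·(σ₂τ₂·d₂)) + q₂))`.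
Every size is a binder; nothing is asserted of Bałaban's densities. [folklore] -/
theorem condMeanGap_of_varianceBound [CompleteSpace E] {s : Finset (PBond P j)} {χ₁ χ₂ h₁ h₂ : Density P j G}
    {C : ℝ} (hP : TermProvisos s (fun U => χ₂ U * Real.exp (h₂ U)) (fun U => χ₁ U * Real.exp (h₁ U)) C)
    (hχ₁m : Measurable χ₁) (hh₁m : Measurable h₁) (hχ₁0 : ∀ U, 0 ≤ χ₁ U) (hχ₂m : Measurable χ₂)
    (hh₂m : Measurable h₂) (hχ₂0 : ∀ U, 0 ≤ χ₂ U) {u₁ u₂ : GaugeField P j G}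
    (hu₁ : fibreIntegral s (fun U => χ₁ U * Real.exp (h₁ U)) u₁ ≠ 0) {g : Density P j G} (hg : Measurable g)
    {Bg : ℝ} (hBg : ∀ U, |g U| ≤ Bg) {m : Density P j G} (hmm : Measurable m) {Bm : ℝ} (hBm : ∀ U, |m U| ≤ Bm)
    (hmI : FibreIndep s m) (t : ℝ) {S : Finset β} {a : β → E} {A : ℝ} (hA : ∀ b ∈ S, ‖a b‖ ≤ A)
    {B : (s → G) → β → E} (hB : ∀ b ∈ S, StronglyMeasurable fun y => B y b) {R : ℝ}
    (hR : ∀ b ∈ S, ∀ y, ‖B y b‖ ≤ R)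
    (hflat₁ : MeanVanishes S fun b => ∫ y, B y b ∂condLaw s (fun U => χ₁ U * Real.exp (h₁ U)) u₁)
    (hflat₂ : MeanVanishes S fun b => ∫ y, B y b ∂condLaw s (fun U => χ₂ U * Real.exp (h₂ U)) u₂)
    {dev₁ dev₂ : GaugeField P j G → ℝ} {σ₁ τ₁ σ₂ τ₂ d₁ d₂ q₁ q₂ : ℝ} (hσ₁ : 0 ≤ σ₁) (hτ₁ : 0 ≤ τ₁)
    (hσ₂ : 0 ≤ σ₂) (hτ₂ : 0 ≤ τ₂)
    (hdom₁ : liveSet s (fun U => χ₁ U * Real.exp (h₁ U)) ⊆ respDom s χ₁ h₁ u₁ B S dev₁ σ₁ τ₁)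
    (hdom₂ : liveSet s (fun U => χ₁ U * Real.exp (h₁ U)) ⊆ respDom s χ₂ h₂ u₂ B S dev₂ σ₂ τ₂)
    (hdev₁ : ∀ V ∈ liveSet s (fun U => χ₁ U * Real.exp (h₁ U)), dev₁ V ≤ d₁)
    (hdev₂ : ∀ V ∈ liveSet s (fun U => χ₁ U * Real.exp (h₁ U)), dev₂ V ≤ d₂)
    (hq₁ : ∀ (V : GaugeField P j G) (y : s → G), χ₁ (updateFinset V s y) * Real.exp (h₁ (updateFinset V s y)) ≠ 0 →
      |g (updateFinset V s y) - m V - linDensity t S a (fibreReading s B) (updateFinset V s y)| ≤ q₁)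
    (hq₂ : ∀ V ∈ liveSet s (fun U => χ₁ U * Real.exp (h₁ U)), ∀ y : s → G,
      χ₂ (updateFinset V s y) * Real.exp (h₂ (updateFinset V s y)) ≠ 0 →
      |g (updateFinset V s y) - m V - linDensity t S a (fibreReading s B) (updateFinset V s y)| ≤ q₂) :
    CondMeanGap s (fun U => χ₂ U * Real.exp (h₂ U)) (fun U => χ₁ U * Real.exp (h₁ U)) g
      ((|t| * ((S.card : ℝ) * A * (σ₁ * τ₁ * d₁)) + q₁) + (|t| * ((S.card : ℝ) * A * (σ₂ * τ₂ * d₂)) + q₂)) :=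
  condMeanGap_of_suppression hP hg hBg hmm hBm hmI t hA (fun b hb => stronglyMeasurable_fibreReading s (hB b hb))
    (fun b hb U => hR b hb (onFibre s U))
    (condMeanSuppression_reading_of_varianceBound s hχ₁m hh₁m hχ₁0 hP.old_le hu₁
      (fun b hb => (hB b hb).aestronglyMeasurable) hR hσ₁ hτ₁ hflat₁)
    (condMeanSuppression_reading_of_varianceBound s hχ₂m hh₂m hχ₂0 hP.ins_le (hP.den_ne u₂)
      (fun b hb => (hB b hb).aestronglyMeasurable) hR hσ₂ hτ₂ hflat₂)
    hdom₁ hdom₂ hdev₁ hdev₂ (mul_nonneg hσ₁ hτ₁) (mul_nonneg hσ₂ hτ₂) hq₁ hq₂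

/-- (I8) … and the increment bound for a nonnegative weight:
`|termDefect s ins old g| ≤ ((|t|·(|S|·A·(σ₁τ₁·d₁)) + q₁) + (|t|·(|S|·A·(σ₂τ₂·d₂)) + q₂))·∫dV old`. [folklore] -/
theorem abs_termDefect_le_of_varianceBound [CompleteSpace E] {s : Finset (PBond P j)} {χ₁ χ₂ h₁ h₂ : Density P j G}
    {C : ℝ} (hP : TermProvisos s (fun U => χ₂ U * Real.exp (h₂ U)) (fun U => χ₁ U * Real.exp (h₁ U)) C)
    (hχ₁m : Measurable χ₁) (hh₁m : Measurable h₁) (hχ₁0 : ∀ U, 0 ≤ χ₁ U) (hχ₂m : Measurable χ₂)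
    (hh₂m : Measurable h₂) (hχ₂0 : ∀ U, 0 ≤ χ₂ U) {u₁ u₂ : GaugeField P j G}
    (hu₁ : fibreIntegral s (fun U => χ₁ U * Real.exp (h₁ U)) u₁ ≠ 0) {g : Density P j G} (hg : Measurable g)
    (hg0 : ∀ U, 0 ≤ g U) {Bg : ℝ} (hgB : ∀ U, g U ≤ Bg) {m : Density P j G} (hmm : Measurable m) {Bm : ℝ}
    (hBm : ∀ U, |m U| ≤ Bm) (hmI : FibreIndep s m) (t : ℝ) {S : Finset β} {a : β → E} {A : ℝ}
    (hA : ∀ b ∈ S, ‖a b‖ ≤ A) {B : (s → G) → β → E} (hB : ∀ b ∈ S, StronglyMeasurable fun y => B y b) {R : ℝ}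
    (hR : ∀ b ∈ S, ∀ y, ‖B y b‖ ≤ R)
    (hflat₁ : MeanVanishes S fun b => ∫ y, B y b ∂condLaw s (fun U => χ₁ U * Real.exp (h₁ U)) u₁)
    (hflat₂ : MeanVanishes S fun b => ∫ y, B y b ∂condLaw s (fun U => χ₂ U * Real.exp (h₂ U)) u₂)
    {dev₁ dev₂ : GaugeField P j G → ℝ} {σ₁ τ₁ σ₂ τ₂ d₁ d₂ q₁ q₂ : ℝ} (hσ₁ : 0 ≤ σ₁) (hτ₁ : 0 ≤ τ₁)
    (hσ₂ : 0 ≤ σ₂) (hτ₂ : 0 ≤ τ₂)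
    (hdom₁ : liveSet s (fun U => χ₁ U * Real.exp (h₁ U)) ⊆ respDom s χ₁ h₁ u₁ B S dev₁ σ₁ τ₁)
    (hdom₂ : liveSet s (fun U => χ₁ U * Real.exp (h₁ U)) ⊆ respDom s χ₂ h₂ u₂ B S dev₂ σ₂ τ₂)
    (hdev₁ : ∀ V ∈ liveSet s (fun U => χ₁ U * Real.exp (h₁ U)), dev₁ V ≤ d₁)
    (hdev₂ : ∀ V ∈ liveSet s (fun U => χ₁ U * Real.exp (h₁ U)), dev₂ V ≤ d₂)
    (hq₁ : ∀ (V : GaugeField P j G) (y : s → G), χ₁ (updateFinset V s y) * Real.exp (h₁ (updateFinset V s y)) ≠ 0 →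
      |g (updateFinset V s y) - m V - linDensity t S a (fibreReading s B) (updateFinset V s y)| ≤ q₁)
    (hq₂ : ∀ V ∈ liveSet s (fun U => χ₁ U * Real.exp (h₁ U)), ∀ y : s → G,
      χ₂ (updateFinset V s y) * Real.exp (h₂ (updateFinset V s y)) ≠ 0 →
      |g (updateFinset V s y) - m V - linDensity t S a (fibreReading s B) (updateFinset V s y)| ≤ q₂) :
    |termDefect s (fun U => χ₂ U * Real.exp (h₂ U)) (fun U => χ₁ U * Real.exp (h₁ U)) g|
      ≤ ((|t| * ((S.card : ℝ) * A * (σ₁ * τ₁ * d₁)) + q₁) + (|t| * ((S.card : ℝ) * A * (σ₂ * τ₂ * d₂)) + q₂))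
        * ∫ V, χ₁ V * Real.exp (h₁ V) ∂fieldMeasure P j G :=
  abs_termDefect_le_of_condMeanGap hP hg hg0 hgB
    (condMeanGap_of_varianceBound hP hχ₁m hh₁m hχ₁0 hχ₂m hh₂m hχ₂0 hu₁ hg
      (fun U => by rw [abs_of_nonneg (hg0 U)]; exact hgB U) hmm hBm hmI t hA hB hR hflat₁ hflat₂ hσ₁ hτ₁ hσ₂ hτ₂
      hdom₁ hdom₂ hdev₁ hdev₂ hq₁ hq₂)

/-! ## §4  ROUTE (P) — THE PAIR RESPONSE AT A FIXED EXTERIOR: the two conditional laws of ONE term as the endpoints of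
one exponential interpolation IN THE LAW (no reference exterior, no `MeanVanishes`, no flatness; localised by
construction on the old term's live set) -/

omit [GaugeGroup G] [MeasurableSpace G] [HaarData G] in
/-- THE EXPONENT GAP BETWEEN THE TWO LAWS on the fibre through `V`: `y ↦ h₁(V←y) − h₂(V←y)` for `old = χ₁·e^{h₁}`,
`ins = χ₂·e^{h₂}` — the fibre restriction of `log(old/ins)` off the windows.  A FIBRE-INDEPENDENT summand of it (any
`κ V`) is invisible to everything below (the free constant of (P3′)/`pairOsc`). [folklore] -/
def lawGap (s : Finset (PBond P j)) (h₁ h₂ : Density P j G) (V : GaugeField P j G) : (s → G) → ℝ :=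
  fun y => h₁ (updateFinset V s y) - h₂ (updateFinset V s y)

omit [GaugeGroup G] [MeasurableSpace G] [HaarData G] in
/-- Unfolding lemma. [folklore] -/
theorem lawGap_apply (s : Finset (PBond P j)) (h₁ h₂ : Density P j G) (V : GaugeField P j G) (y : s → G) :
    lawGap s h₁ h₂ V y = h₁ (updateFinset V s y) - h₂ (updateFinset V s y) := rfl

omit [GaugeGroup G] [MeasurableSpace G] [HaarData G] in
/-- The gap of a law with itself vanishes. [folklore] -/
theorem lawGap_self (s : Finset (PBond P j)) (h : Density P j G) (V : GaugeField P j G) :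
    lawGap s h h V = fun _ => 0 := funext fun _ => sub_self _

omit [GaugeGroup G] [MeasurableSpace G] [HaarData G] in
/-- **(P1) THE TWO FIBRE DENSITIES OF ONE TERM INTERPOLATE EXPONENTIALLY** when the windows AGREE on the fibre through
`V` (`χ₂(V←y) = χ₁(V←y)`): `ins(V←y) = old(V←y)·e^{−lawGap(y)}`, i.e. the insert's fibre density is the `θ = 1`
exponential tilt (`T4CovarianceResponse.expTilt`) of the old term's by the law gap. [folklore] -/
theorem fibreDensity_eq_expTilt_lawGap (s : Finset (PBond P j)) (χ₁ χ₂ h₁ h₂ : Density P j G) {V : GaugeField P j G}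
    (hwin : ∀ y : s → G, χ₂ (updateFinset V s y) = χ₁ (updateFinset V s y)) :
    fibreDensity s (fun U => χ₂ U * Real.exp (h₂ U)) V =
      expTilt (fibreDensity s (fun U => χ₁ U * Real.exp (h₁ U)) V) (lawGap s h₁ h₂ V) 1 := by
  funext y
  simp only [fibreDensity, expTilt_apply, lawGap_apply, one_mul]
  rw [hwin y, mul_assoc, ← Real.exp_add]
  congr 2
  ring

/-- THE LAW PATH at the fixed exterior `V`: the tilted laws `θ ↦ normLaw (fibreBase s) (old(V←·)·e^{−θ·lawGap})`
between `condLaw s old V` (`θ = 0`) and — for fibre-agreeing windows — `condLaw s ins V` (`θ = 1`). [folklore] -/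
def lawPath (s : Finset (PBond P j)) (χ h₁ h₂ : Density P j G) (V : GaugeField P j G) (θ : ℝ) : Measure (s → G) :=
  tiltLaw (fibreBase s) (fibreDensity s (fun U => χ U * Real.exp (h₁ U)) V) (lawGap s h₁ h₂ V) θ

/-- THE LAW-PATH VARIANCE of an insert `F` on the fibre at `θ` (for `F = lawGap s h₁ h₂ V`: of the law gap) — the
quantity the (PVAR) inputs bound. [folklore] -/
def lawPathVar (s : Finset (PBond P j)) (χ h₁ h₂ : Density P j G) (V : GaugeField P j G) (F : (s → G) → E)
    (θ : ℝ) : ℝ :=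
  tiltVar (fibreBase s) (fibreDensity s (fun U => χ U * Real.exp (h₁ U)) V) (lawGap s h₁ h₂ V) F θ

/-- The old term's conditional law is the law path at `θ = 0`. [folklore] -/
theorem condLaw_eq_lawPath_zero (s : Finset (PBond P j)) (χ h₁ h₂ : Density P j G) (V : GaugeField P j G) :
    condLaw s (fun U => χ U * Real.exp (h₁ U)) V = lawPath s χ h₁ h₂ V 0 :=
  condLaw_eq_tiltLaw_zero s _ V _

/-- For fibre-agreeing windows the insert's conditional law is the law path at `θ = 1`. [folklore] -/
theorem condLaw_eq_lawPath_one (s : Finset (PBond P j)) {χ₁ χ₂ : Density P j G} (h₁ h₂ : Density P j G)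
    {V : GaugeField P j G} (hwin : ∀ y : s → G, χ₂ (updateFinset V s y) = χ₁ (updateFinset V s y)) :
    condLaw s (fun U => χ₂ U * Real.exp (h₂ U)) V = lawPath s χ₁ h₁ h₂ V 1 := by
  rw [condLaw_eq_normLaw, lawPath, tiltLaw, fibreDensity_eq_expTilt_lawGap s χ₁ χ₂ h₁ h₂ hwin]

/-- The law path of a law with itself is constant `= condLaw s old V`. [folklore] -/
theorem lawPath_self (s : Finset (PBond P j)) (χ h : Density P j G) (V : GaugeField P j G) (θ : ℝ) :
    lawPath s χ h h V θ = condLaw s (fun U => χ U * Real.exp (h U)) V := by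
  rw [lawPath, tiltLaw, lawGap_self, expTilt_const_zero, ← condLaw_eq_normLaw]

/-- … so its path variances are the variances under `condLaw s old V`. [folklore] -/
theorem lawPathVar_self (s : Finset (PBond P j)) (χ h : Density P j G) (V : GaugeField P j G) (F : (s → G) → E)
    (θ : ℝ) :
    lawPathVar s χ h h V F θ = ∫ y, ‖F y - ∫ z, F z ∂condLaw s (fun U => χ U * Real.exp (h U)) V‖ ^ 2
      ∂condLaw s (fun U => χ U * Real.exp (h U)) V := by
  rw [lawPathVar, tiltVar, tiltMean, ← lawPath, lawPath_self]

/-- THE STANDING DATA ON THE LAW PATH: a measurable Gibbs law `0 ≤ χ₁e^{h₁} ≤ C` live at `V`, a measurable second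
exponent `h₂` and a bounded law gap give `TiltData` for the base law of the fibre. [folklore] -/
theorem tiltData_law (s : Finset (PBond P j)) {χ h₁ h₂ : Density P j G} (hχm : Measurable χ) (hh₁ : Measurable h₁)
    (hh₂ : Measurable h₂) (hχ0 : ∀ U, 0 ≤ χ U) {C : ℝ} (hC : ∀ U, χ U * Real.exp (h₁ U) ≤ C) {V : GaugeField P j G}
    (hne : fibreIntegral s (fun U => χ U * Real.exp (h₁ U)) V ≠ 0) {K : ℝ}
    (hK : ∀ y : s → G, |lawGap s h₁ h₂ V y| ≤ K) :
    TiltData (fibreBase s) (fibreDensity s (fun U => χ U * Real.exp (h₁ U)) V) (lawGap s h₁ h₂ V) where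
  measurable_q := measurable_fibreDensity s (hχm.mul (Real.measurable_exp.comp hh₁)) V
  nonneg_q _ := mul_nonneg (hχ0 _) (Real.exp_nonneg _)
  bdd_q := ⟨C, fun _ => hC _⟩
  pos_q := integral_fibreDensity_pos s (hχm.mul (Real.measurable_exp.comp hh₁))
    (fun U => mul_nonneg (hχ0 U) (Real.exp_nonneg _)) hC hne
  measurable_g := (hh₁.comp measurable_updateFinset).sub (hh₂.comp measurable_updateFinset)
  bdd_g := ⟨K, hK⟩

/-- **(P2) THE PAIR RESPONSE BOUND AT ONE EXTERIOR.**  For `old = χ₁·e^{h₁}` (measurable data, `0 ≤ χ₁`, `old ≤ C`)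
live at `V`, a second measurable exponent `h₂` and a window `χ₂` agreeing with `χ₁` on the fibre through `V`, a bounded
law gap, a bounded a.e.-strongly-measurable insert `F`, and LAW-PATH VARIANCE BOUNDS (inputs, caveat (PVAR))
`Var_θ(lawGap) ≤ Vg`, `Var_θ(F) ≤ VF` on `θ ∈ [0,1]`:
`‖∫F ∂condLaw s ins V − ∫F ∂condLaw s old V‖ ≤ √Vg·√VF` — `T4CovarianceResponse.norm_tiltMean_one_sub_zero_le`
(response identity + Cauchy–Schwarz + mean value inequality) on the law path. [folklore] -/
theorem norm_condMean_pair_sub_le_of_varianceBound [CompleteSpace E] (s : Finset (PBond P j))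
    {χ₁ χ₂ h₁ h₂ : Density P j G} (hχm : Measurable χ₁) (hh₁ : Measurable h₁) (hh₂ : Measurable h₂)
    (hχ0 : ∀ U, 0 ≤ χ₁ U) {C : ℝ} (hC : ∀ U, χ₁ U * Real.exp (h₁ U) ≤ C) {V : GaugeField P j G}
    (hne : fibreIntegral s (fun U => χ₁ U * Real.exp (h₁ U)) V ≠ 0)
    (hwin : ∀ y : s → G, χ₂ (updateFinset V s y) = χ₁ (updateFinset V s y)) {K : ℝ}
    (hK : ∀ y : s → G, |lawGap s h₁ h₂ V y| ≤ K) {F : (s → G) → E} (hF : AEStronglyMeasurable F (fibreBase s))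
    {R : ℝ} (hR : ∀ y, ‖F y‖ ≤ R) {Vg VF : ℝ}
    (hVg : ∀ θ ∈ Set.Icc (0 : ℝ) 1, lawPathVar s χ₁ h₁ h₂ V (lawGap s h₁ h₂ V) θ ≤ Vg)
    (hVF : ∀ θ ∈ Set.Icc (0 : ℝ) 1, lawPathVar s χ₁ h₁ h₂ V F θ ≤ VF) :
    ‖(∫ y, F y ∂condLaw s (fun U => χ₂ U * Real.exp (h₂ U)) V) -
        ∫ y, F y ∂condLaw s (fun U => χ₁ U * Real.exp (h₁ U)) V‖ ≤ Real.sqrt Vg * Real.sqrt VF := by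
  rw [condLaw_eq_lawPath_one s h₁ h₂ hwin, condLaw_eq_lawPath_zero s χ₁ h₁ h₂ V]
  exact norm_tiltMean_one_sub_zero_le (tiltData_law s hχm hh₁ hh₂ hχ0 hC hne hK) hF hR hVg hVF

/-- **(P2′) THE OSCILLATION FORM** (unconditional): a law gap within `ε` of a FREE CONSTANT `κ` on the fibre through `V`
(so any fibre-independent part of `log(old/ins)` — normalisations, terms living off the fibre — costs nothing) and an
insert with `‖F − c‖ ≤ M` give `‖∫F ∂condLaw s ins V − ∫F ∂condLaw s old V‖ ≤ ε·(2M)` —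
`T4CovarianceResponse.norm_tiltMean_one_sub_zero_le_of_osc` on the law path. [folklore] -/
theorem norm_condMean_pair_sub_le_of_osc [CompleteSpace E] (s : Finset (PBond P j)) {χ₁ χ₂ h₁ h₂ : Density P j G}
    (hχm : Measurable χ₁) (hh₁ : Measurable h₁) (hh₂ : Measurable h₂) (hχ0 : ∀ U, 0 ≤ χ₁ U) {C : ℝ}
    (hC : ∀ U, χ₁ U * Real.exp (h₁ U) ≤ C) {V : GaugeField P j G}
    (hne : fibreIntegral s (fun U => χ₁ U * Real.exp (h₁ U)) V ≠ 0)
    (hwin : ∀ y : s → G, χ₂ (updateFinset V s y) = χ₁ (updateFinset V s y)) {κ ε : ℝ}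
    (hε : ∀ y : s → G, |lawGap s h₁ h₂ V y - κ| ≤ ε) (hε0 : 0 ≤ ε) {F : (s → G) → E}
    (hF : AEStronglyMeasurable F (fibreBase s)) {c : E} {M : ℝ} (hM : ∀ y, ‖F y - c‖ ≤ M) (hM0 : 0 ≤ M) :
    ‖(∫ y, F y ∂condLaw s (fun U => χ₂ U * Real.exp (h₂ U)) V) -
        ∫ y, F y ∂condLaw s (fun U => χ₁ U * Real.exp (h₁ U)) V‖ ≤ ε * (2 * M) := by
  have hK : ∀ y : s → G, |lawGap s h₁ h₂ V y| ≤ ε + |κ| := fun y =>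
    calc |lawGap s h₁ h₂ V y| = |(lawGap s h₁ h₂ V y - κ) + κ| := by rw [sub_add_cancel]
      _ ≤ |lawGap s h₁ h₂ V y - κ| + |κ| := abs_add_le _ _
      _ ≤ ε + |κ| := add_le_add (hε y) le_rfl
  rw [condLaw_eq_lawPath_one s h₁ h₂ hwin, condLaw_eq_lawPath_zero s χ₁ h₁ h₂ V]
  exact norm_tiltMean_one_sub_zero_le_of_osc (tiltData_law s hχm hh₁ hh₂ hχ0 hC hne hK) hF hε hε0 hM hM0

omit [GaugeGroup G] [MeasurableSpace G] [HaarData G] [DecidableEq (PBond P j)] in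
/-- Linearity of the first-order term in the insert: `linTerm t S a m₁ − linTerm t S a m₂ = linTerm t S a (m₁ − m₂)`.
[folklore] -/
theorem linTerm_sub (t : ℝ) (S : Finset β) (a m₁ m₂ : β → E) :
    linTerm t S a m₁ - linTerm t S a m₂ = linTerm t S a (fun b => m₁ b - m₂ b) := by
  unfold linTerm
  rw [← mul_sub, ← Finset.sum_sub_distrib]
  refine congrArg _ (Finset.sum_congr rfl fun b _ => ?_)
  rw [inner_sub_right]

/-- **(P3) THE TWO-LAW GAP OF A LINEAR DENSITY FROM A PER-BOND GAP OF THE CONDITIONAL MEAN FIELDS.**  For two laws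
`w₁, w₂ ≤ C` and a bond-insert field `Φ` (strongly measurable bounded components), a per-bond bound
`‖E^{w₁}_s[Φ b | V_out] − E^{w₂}_s[Φ b | V_out]‖ ≤ r` on `S` gives
`|E^{w₁}_s[linDensity t S a Φ | V_out] − E^{w₂}_s[linDensity t S a Φ | V_out]| ≤ |t|·(|S|·A·r)` —
`T4CondMeanChannel.condMean_linDensity` twice, `linTerm_sub`, `T4FirstOrderSize.abs_linTerm_le_sup`. [folklore] -/
theorem abs_condMean_linDensity_pair_le [CompleteSpace E] (s : Finset (PBond P j)) {w₁ w₂ : Density P j G} {C : ℝ}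
    (hC₁ : ∀ U, w₁ U ≤ C) (hC₂ : ∀ U, w₂ U ≤ C) (t : ℝ) {S : Finset β} {a : β → E} {A : ℝ}
    (hA : ∀ b ∈ S, ‖a b‖ ≤ A) {Φ : GaugeField P j G → β → E} (hΦ : ∀ b ∈ S, StronglyMeasurable fun U => Φ U b)
    {R : ℝ} (hR : ∀ b ∈ S, ∀ U, ‖Φ U b‖ ≤ R) {V : GaugeField P j G} {r : ℝ}
    (hr : ∀ b ∈ S, ‖condMeanField s w₁ Φ V b - condMeanField s w₂ Φ V b‖ ≤ r) :
    |condMean s w₁ (linDensity t S a Φ) V - condMean s w₂ (linDensity t S a Φ) V| ≤ |t| * ((S.card : ℝ) * A * r) := by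
  rw [condMean_linDensity s hC₁ t a hΦ hR V, condMean_linDensity s hC₂ t a hΦ hR V, linTerm_sub]
  exact abs_linTerm_le_sup hA hr t

/-- THE PAIR-RESPONSE DOMAIN of exteriors `V` for one term with Gibbs laws `old = χ₁e^{h₁}`, `ins = χ₂e^{h₂}`, bond
inserts `B` on `S` and two moduli `σ, τ`: the windows agree on the fibre through `V`, the law gap is bounded there, and
along the law path the variance of the gap is `≤ σ²` and that of each insert `≤ τ²`.  The variance conditions are the
(PVAR) INPUTS — NOT PROVED for Bałaban's densities. [folklore] -/
def pairDom (s : Finset (PBond P j)) (χ₁ χ₂ h₁ h₂ : Density P j G) (B : (s → G) → β → E) (S : Finset β) (σ τ : ℝ) :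
    Set (GaugeField P j G) :=
  {V | (∀ y : s → G, χ₂ (updateFinset V s y) = χ₁ (updateFinset V s y)) ∧
    (∃ K : ℝ, ∀ y : s → G, |lawGap s h₁ h₂ V y| ≤ K) ∧
    (∀ θ ∈ Set.Icc (0 : ℝ) 1, lawPathVar s χ₁ h₁ h₂ V (lawGap s h₁ h₂ V) θ ≤ σ ^ 2) ∧
    ∀ b ∈ S, ∀ θ ∈ Set.Icc (0 : ℝ) 1, lawPathVar s χ₁ h₁ h₂ V (fun y => B y b) θ ≤ τ ^ 2}

/-- Non-vacuity: for `ins = old` (same window, same exponent) an exterior lies in the pair domain as soon as `0 ≤ σ` and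
the variances of the inserts under `condLaw s old V` are `≤ τ²` (the law gap vanishes identically). [folklore] -/
theorem mem_pairDom_self (s : Finset (PBond P j)) (χ h : Density P j G) (B : (s → G) → β → E) (S : Finset β)
    {σ τ : ℝ} {V : GaugeField P j G}
    (hτ : ∀ b ∈ S, ∫ y, ‖B y b - ∫ z, B z b ∂condLaw s (fun U => χ U * Real.exp (h U)) V‖ ^ 2
      ∂condLaw s (fun U => χ U * Real.exp (h U)) V ≤ τ ^ 2) :
    V ∈ pairDom s χ χ h h B S σ τ := by
  refine ⟨fun _ => rfl, ⟨0, fun y => by rw [lawGap_apply, sub_self, abs_zero]⟩, fun θ _ => ?_, fun b hb θ _ => ?_⟩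
  · rw [lawPathVar_self, lawGap_self]
    simp only [sub_self, norm_zero, ne_eq, OfNat.ofNat_ne_zero, not_false_eq_true, zero_pow, integral_zero]
    exact sq_nonneg _
  · rw [lawPathVar_self]
    exact hτ b hb

/-- **(P4) THE DIRECT TWO-LAW CHANNEL OF THE LINEAR PART.**  For one term with Gibbs laws `old = χ₁e^{h₁}`,
`ins = χ₂e^{h₂}` (`χ₁, h₁, h₂` measurable, `0 ≤ χ₁`, both laws `≤ C`), bond inserts `B` strongly measurable and bounded
on `S`, moduli `σ, τ ≥ 0`, and the OLD term's live set inside the pair-response domain: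
`CondMeanGap s ins old (linDensity t S a (fibreReading s B)) (|t|·(|S|·A·(σ·τ)))` — the two-law gap OF THE LINEAR PART
in one stroke, with NO reference exterior, NO `MeanVanishes` and NO deviation-from-flatness functional: the input is the
variance of the LAW GAP on the fibre (and of the inserts) under the laws interpolating `old ↔ ins` at the same exterior.
[folklore] -/
theorem condMeanGap_linDensity_of_pairVariance [CompleteSpace E] (s : Finset (PBond P j))
    {χ₁ χ₂ h₁ h₂ : Density P j G} (hχm : Measurable χ₁) (hh₁ : Measurable h₁) (hh₂ : Measurable h₂)
    (hχ0 : ∀ U, 0 ≤ χ₁ U) {C : ℝ} (hC₁ : ∀ U, χ₁ U * Real.exp (h₁ U) ≤ C)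
    (hC₂ : ∀ U, χ₂ U * Real.exp (h₂ U) ≤ C) {B : (s → G) → β → E} {S : Finset β}
    (hB : ∀ b ∈ S, StronglyMeasurable fun y => B y b) {R : ℝ} (hR : ∀ b ∈ S, ∀ y, ‖B y b‖ ≤ R) {σ τ : ℝ}
    (hσ : 0 ≤ σ) (hτ : 0 ≤ τ)
    (hdom : liveSet s (fun U => χ₁ U * Real.exp (h₁ U)) ⊆ pairDom s χ₁ χ₂ h₁ h₂ B S σ τ) (t : ℝ) {a : β → E}
    {A : ℝ} (hA : ∀ b ∈ S, ‖a b‖ ≤ A) :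
    CondMeanGap s (fun U => χ₂ U * Real.exp (h₂ U)) (fun U => χ₁ U * Real.exp (h₁ U))
      (linDensity t S a (fibreReading s B)) (|t| * ((S.card : ℝ) * A * (σ * τ))) := by
  intro V hne
  obtain ⟨hwin, ⟨K, hK⟩, hVg, hVF⟩ := hdom hne
  refine abs_condMean_linDensity_pair_le s hC₁ hC₂ t hA (fun b hb => stronglyMeasurable_fibreReading s (hB b hb))
    (fun b hb U => hR b hb (onFibre s U)) fun b hb => ?_
  rw [condMeanField_fibreReading, condMeanField_fibreReading]
  have h := norm_condMean_pair_sub_le_of_varianceBound s hχm hh₁ hh₂ hχ0 hC₁ hne hwin hK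
    (hB b hb).aestronglyMeasurable (hR b hb) hVg (hVF b hb)
  rw [Real.sqrt_sq hσ, Real.sqrt_sq hτ, norm_sub_rev] at h
  exact h

/-- **(P4′) THE DIRECT TWO-LAW CHANNEL, OSCILLATION FORM** (unconditional in the variances): windows agreeing on the
fibre at every old-live exterior, a law gap within `ε` of a free FIBRE-INDEPENDENT functional `κ V` there, and inserts
with oscillation `≤ M` about centres `c`: `CondMeanGap s ins old (linDensity t S a (fibreReading s B)) (|t|·(|S|·A·(ε·2M)))`.
[folklore] -/
theorem condMeanGap_linDensity_of_pairOsc [CompleteSpace E] (s : Finset (PBond P j)) {χ₁ χ₂ h₁ h₂ : Density P j G}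
    (hχm : Measurable χ₁) (hh₁ : Measurable h₁) (hh₂ : Measurable h₂) (hχ0 : ∀ U, 0 ≤ χ₁ U) {C : ℝ}
    (hC₁ : ∀ U, χ₁ U * Real.exp (h₁ U) ≤ C) (hC₂ : ∀ U, χ₂ U * Real.exp (h₂ U) ≤ C) {B : (s → G) → β → E}
    {S : Finset β} (hB : ∀ b ∈ S, StronglyMeasurable fun y => B y b) {c : β → E} {M : ℝ}
    (hM : ∀ b ∈ S, ∀ y, ‖B y b - c b‖ ≤ M)
    (hwin : ∀ V ∈ liveSet s (fun U => χ₁ U * Real.exp (h₁ U)), ∀ y : s → G,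
      χ₂ (updateFinset V s y) = χ₁ (updateFinset V s y))
    {κ : GaugeField P j G → ℝ} {ε : ℝ}
    (hε : ∀ V ∈ liveSet s (fun U => χ₁ U * Real.exp (h₁ U)), ∀ y : s → G, |lawGap s h₁ h₂ V y - κ V| ≤ ε)
    (hε0 : 0 ≤ ε) (t : ℝ) {a : β → E} {A : ℝ} (hA : ∀ b ∈ S, ‖a b‖ ≤ A) :
    CondMeanGap s (fun U => χ₂ U * Real.exp (h₂ U)) (fun U => χ₁ U * Real.exp (h₁ U))
      (linDensity t S a (fibreReading s B)) (|t| * ((S.card : ℝ) * A * (ε * (2 * M)))) := by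
  intro V hne
  refine abs_condMean_linDensity_pair_le s hC₁ hC₂ t hA (fun b hb => stronglyMeasurable_fibreReading s (hB b hb))
    (fun b hb U => norm_le_of_osc hM b hb _) fun b hb => ?_
  rw [condMeanField_fibreReading, condMeanField_fibreReading]
  have h := norm_condMean_pair_sub_le_of_osc s hχm hh₁ hh₂ hχ0 hC₁ hne (hwin V hne) (hε V hne) hε0
    (hB b hb).aestronglyMeasurable (hM b hb) (osc_nonneg hM hb)
  rw [norm_sub_rev] at h
  exact h

/-! ### The full weight: the reference cancels between the two laws, the remainders add -/

/-- THE CENTRED SPLIT AT ONE LIVE EXTERIOR (identity): `E^{w}_s[g | V_out] − m V = E^{w}_s[g − m − ℓ | V_out] +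
E^{w}_s[ℓ | V_out]` for bounded measurable `g, m, ℓ`, `m` fibre-independent, `w ≤ C` live at `V`
(`T4ObservableTelescope.condMean_sub`, `condMean_of_fibreIndep`). [folklore] -/
theorem condMean_sub_ref_eq (s : Finset (PBond P j)) {w : Density P j G} {C : ℝ} (hC : ∀ U, w U ≤ C)
    {g m ℓ : Density P j G} (hg : Measurable g) (hmm : Measurable m) (hℓ : Measurable ℓ) {Bg Bm Bℓ : ℝ}
    (hBg : ∀ U, |g U| ≤ Bg) (hBm : ∀ U, |m U| ≤ Bm) (hBℓ : ∀ U, |ℓ U| ≤ Bℓ) (hmI : FibreIndep s m)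
    {V : GaugeField P j G} (hne : fibreIntegral s w V ≠ 0) :
    condMean s w g V - m V = condMean s w (fun U => g U - m U - ℓ U) V + condMean s w ℓ V := by
  have hgm : ∀ U, |g U - m U| ≤ Bg + Bm := fun U => (abs_sub _ _).trans (add_le_add (hBg U) (hBm U))
  rw [condMean_sub s hC (hg.sub hmm) hℓ (g₁ := fun U => g U - m U) hgm hBℓ V, condMean_sub s hC hg hmm hBg hBm V,
    condMean_of_fibreIndep s hC hmI V hne]
  ring

/-- THE REMAINDER CHANNEL AT ONE LIVE EXTERIOR: a bound `|g(V←y) − m V − ℓ(V←y)| ≤ q` on the support of `w(V←·)`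
gives `|E^{w}_s[g − m − ℓ | V_out]| ≤ q` (`m` fibre-independent; the conditional law is a probability measure carried
by the support). [folklore] -/
theorem abs_condMean_rem_le (s : Finset (PBond P j)) {w : Density P j G} (hm : Measurable w) {C : ℝ}
    (hC : ∀ U, w U ≤ C) {g m ℓ : Density P j G} (hmI : FibreIndep s m) {V : GaugeField P j G}
    (hne : fibreIntegral s w V ≠ 0) {q : ℝ}
    (hq : ∀ y : s → G, w (updateFinset V s y) ≠ 0 → |g (updateFinset V s y) - m V - ℓ (updateFinset V s y)| ≤ q) :
    |condMean s w (fun U => g U - m U - ℓ U) V| ≤ q := by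
  haveI := isProbabilityMeasure_condLaw s hC V hne
  rw [condMean, ← Real.norm_eq_abs]
  have h := norm_integral_le_of_norm_le_const (μ := condLaw s w V)
    (f := fun y : s → G => g (updateFinset V s y) - m (updateFinset V s y) - ℓ (updateFinset V s y)) (C := q)
    (ae_condLaw_of_support s hm V fun y hy => by
      rw [Real.norm_eq_abs, hmI V y]; exact hq y hy)
  rwa [probReal_univ, mul_one] at h

/-- **(P5) THE TWO-LAW GAP OF THE FULL WEIGHT FROM A DIRECT CHANNEL OF ITS LINEAR PART.**  Under the printed provisos
of one term, for a bounded measurable weight `g`, a bounded measurable fibre-independent reference `m` and a bounded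
measurable linear part `ℓ`: a DIRECT two-law channel `|E^{old}_s[ℓ | V_out] − E^{ins}_s[ℓ | V_out]| ≤ p` on the old
term's live set and remainder bounds `q₁` (support of `old(V←·)`) / `q₂` (support of `ins(V←·)` at old-live `V`) give
`CondMeanGap s ins old g (p + (q₁ + q₂))` — the reference `m V` CANCELS between the two laws (both conditional laws are
probability measures at an old-live exterior: `den_ne` for the insert). [folklore] -/
theorem condMeanGap_of_pairChannel {s : Finset (PBond P j)} {ins old : Density P j G} {C : ℝ}
    (hP : TermProvisos s ins old C) {g m ℓ : Density P j G} (hg : Measurable g) (hmm : Measurable m)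
    (hℓ : Measurable ℓ) {Bg Bm Bℓ : ℝ} (hBg : ∀ U, |g U| ≤ Bg) (hBm : ∀ U, |m U| ≤ Bm) (hBℓ : ∀ U, |ℓ U| ≤ Bℓ)
    (hmI : FibreIndep s m) {p q₁ q₂ : ℝ} (hp : ∀ V ∈ liveSet s old, |condMean s old ℓ V - condMean s ins ℓ V| ≤ p)
    (hq₁ : ∀ (V : GaugeField P j G) (y : s → G), old (updateFinset V s y) ≠ 0 →
      |g (updateFinset V s y) - m V - ℓ (updateFinset V s y)| ≤ q₁)
    (hq₂ : ∀ V ∈ liveSet s old, ∀ y : s → G, ins (updateFinset V s y) ≠ 0 →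
      |g (updateFinset V s y) - m V - ℓ (updateFinset V s y)| ≤ q₂) :
    CondMeanGap s ins old g (p + (q₁ + q₂)) := by
  intro V hne
  have e₁ := condMean_sub_ref_eq s hP.old_le hg hmm hℓ hBg hBm hBℓ hmI hne
  have e₂ := condMean_sub_ref_eq s hP.ins_le hg hmm hℓ hBg hBm hBℓ hmI (hP.den_ne V)
  have r₁ := abs_condMean_rem_le s hP.old_meas hP.old_le hmI hne (hq₁ V)
  have r₂ := abs_condMean_rem_le s hP.ins_meas hP.ins_le hmI (hP.den_ne V) (hq₂ V hne)
  have e : condMean s old g V - condMean s ins g V =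
      (condMean s old ℓ V - condMean s ins ℓ V) +
        (condMean s old (fun U => g U - m U - ℓ U) V - condMean s ins (fun U => g U - m U - ℓ U) V) := by
    linear_combination e₁ - e₂
  rw [e]
  exact (abs_add_le _ _).trans (add_le_add (hp V hne) ((abs_sub _ _).trans (add_le_add r₁ r₂)))

/-- **(P6) THE INCREMENT, END TO END ON ROUTE (P).**  One term with Gibbs laws `old = χ₁e^{h₁}`, `ins = χ₂e^{h₂}`
under the printed provisos (`χ₁, h₁, h₂` measurable, `0 ≤ χ₁`); a nonnegative bounded measurable weight `g`, a
bounded measurable fibre-independent reference `m`, the linear density of the raw fibre reading of bond inserts `B`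
(strongly measurable, bounded on `S`) as linear part; moduli `σ, τ ≥ 0` with the old term's live set inside
`pairDom s χ₁ χ₂ h₁ h₂ B S σ τ`; remainder bounds `q₁`, `q₂`:
`|termDefect s ins old g| ≤ (|t|·(|S|·A·(σ·τ)) + (q₁ + q₂))·∫dV old` — (P4) ∘ (P5) ∘
`T4ObservableTelescope.abs_termDefect_le_of_condMeanGap`.  Every size is a binder. [folklore] -/
theorem abs_termDefect_le_of_pairVariance [CompleteSpace E] {s : Finset (PBond P j)} {χ₁ χ₂ h₁ h₂ : Density P j G}
    {C : ℝ} (hP : TermProvisos s (fun U => χ₂ U * Real.exp (h₂ U)) (fun U => χ₁ U * Real.exp (h₁ U)) C)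
    (hχm : Measurable χ₁) (hh₁ : Measurable h₁) (hh₂ : Measurable h₂) (hχ0 : ∀ U, 0 ≤ χ₁ U) {g : Density P j G}
    (hg : Measurable g) (hg0 : ∀ U, 0 ≤ g U) {Bg : ℝ} (hgB : ∀ U, g U ≤ Bg) {m : Density P j G} (hmm : Measurable m)
    {Bm : ℝ} (hBm : ∀ U, |m U| ≤ Bm) (hmI : FibreIndep s m) (t : ℝ) {S : Finset β} {a : β → E} {A : ℝ}
    (hA : ∀ b ∈ S, ‖a b‖ ≤ A) {B : (s → G) → β → E} (hB : ∀ b ∈ S, StronglyMeasurable fun y => B y b) {R : ℝ}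
    (hR : ∀ b ∈ S, ∀ y, ‖B y b‖ ≤ R) {σ τ : ℝ} (hσ : 0 ≤ σ) (hτ : 0 ≤ τ)
    (hdom : liveSet s (fun U => χ₁ U * Real.exp (h₁ U)) ⊆ pairDom s χ₁ χ₂ h₁ h₂ B S σ τ) {q₁ q₂ : ℝ}
    (hq₁ : ∀ (V : GaugeField P j G) (y : s → G), χ₁ (updateFinset V s y) * Real.exp (h₁ (updateFinset V s y)) ≠ 0 →
      |g (updateFinset V s y) - m V - linDensity t S a (fibreReading s B) (updateFinset V s y)| ≤ q₁)
    (hq₂ : ∀ V ∈ liveSet s (fun U => χ₁ U * Real.exp (h₁ U)), ∀ y : s → G,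
      χ₂ (updateFinset V s y) * Real.exp (h₂ (updateFinset V s y)) ≠ 0 →
      |g (updateFinset V s y) - m V - linDensity t S a (fibreReading s B) (updateFinset V s y)| ≤ q₂) :
    |termDefect s (fun U => χ₂ U * Real.exp (h₂ U)) (fun U => χ₁ U * Real.exp (h₁ U)) g|
      ≤ (|t| * ((S.card : ℝ) * A * (σ * τ)) + (q₁ + q₂)) * ∫ V, χ₁ V * Real.exp (h₁ V) ∂fieldMeasure P j G :=
  abs_termDefect_le_of_condMeanGap hP hg hg0 hgB
    (condMeanGap_of_pairChannel hP hg hmm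
      (measurable_linDensity t a fun b hb => stronglyMeasurable_fibreReading s (hB b hb))
      (fun U => by rw [abs_of_nonneg (hg0 U)]; exact hgB U) hBm
      (abs_linDensity_le hA fun b hb U => hR b hb (onFibre s U)) hmI
      (condMeanGap_linDensity_of_pairVariance s hχm hh₁ hh₂ hχ0 hP.old_le hP.ins_le hB hR hσ hτ hdom t hA) hq₁ hq₂)

/-! ### The step: the ℝ-defect of one whole basic operation from per-term channels, by name -/

/-- **(S1) ONE ℝ-STEP FROM PER-TERM DIRECT CHANNELS.**  For the real basic operation `RopReal piece pp fib` (every term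
under the printed provisos with a common bound `C`), a nonnegative bounded measurable weight `g`, and PER TERM `Z`: a
bounded measurable fibre-independent reference `m Z`, a bounded measurable linear part `ℓ Z`, a direct two-law channel
`p Z` of `ℓ Z` on the live set of `ρ(Z,·)` and remainder bounds `q₁ Z`, `q₂ Z`:
`|∫(Σ_Z ρ(Z,·))·g − ∫(R ρ)·g| ≤ Σ_Z (p Z + (q₁ Z + q₂ Z))·∫dV ρ(Z,·)` — (P5) per term fed into
`T4ObservableTelescope.abs_defect_ropReal_le_sum` VERBATIM.  This is the per-step size `a k` of
`T4ObservableTelescope.DefectBoundedBy`, the input of `T4ObservableTelescopeTwoRun.uniformGeomDefect_of_defectBoundedBy`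
((W1); the K-uniform geometric decay of these sizes and the summation of the masses are NOT addressed here). [folklore] -/
theorem abs_defect_ropReal_le_of_pairChannels {ι : Type*} [Fintype ι] (piece : ι → Density P j G) (pp : ι → ι)
    (fib : ι → Finset (PBond P j)) {C : ℝ} (hP : ∀ Z, TermProvisos (fib Z) (piece (pp Z)) (piece Z) C)
    {g : GaugeField P j G → ℝ} (hg : Measurable g) (hg0 : ∀ U, 0 ≤ g U) {Bg : ℝ} (hgB : ∀ U, g U ≤ Bg)
    {m ℓ : ι → Density P j G} (hmm : ∀ Z, Measurable (m Z)) (hℓ : ∀ Z, Measurable (ℓ Z)) {Bm Bℓ : ι → ℝ}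
    (hBm : ∀ Z U, |m Z U| ≤ Bm Z) (hBℓ : ∀ Z U, |ℓ Z U| ≤ Bℓ Z) (hmI : ∀ Z, FibreIndep (fib Z) (m Z))
    {p q₁ q₂ : ι → ℝ}
    (hp : ∀ Z, ∀ V ∈ liveSet (fib Z) (piece Z),
      |condMean (fib Z) (piece Z) (ℓ Z) V - condMean (fib Z) (piece (pp Z)) (ℓ Z) V| ≤ p Z)
    (hq₁ : ∀ (Z : ι) (V : GaugeField P j G) (y : fib Z → G), piece Z (updateFinset V (fib Z) y) ≠ 0 →
      |g (updateFinset V (fib Z) y) - m Z V - ℓ Z (updateFinset V (fib Z) y)| ≤ q₁ Z)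
    (hq₂ : ∀ Z, ∀ V ∈ liveSet (fib Z) (piece Z), ∀ y : fib Z → G, piece (pp Z) (updateFinset V (fib Z) y) ≠ 0 →
      |g (updateFinset V (fib Z) y) - m Z V - ℓ Z (updateFinset V (fib Z) y)| ≤ q₂ Z) :
    |(∫ V, (∑ Z, piece Z V) * g V ∂fieldMeasure P j G) - ∫ V, RopReal piece pp fib V * g V ∂fieldMeasure P j G|
      ≤ ∑ Z, (p Z + (q₁ Z + q₂ Z)) * ∫ V, piece Z V ∂fieldMeasure P j G :=
  abs_defect_ropReal_le_sum piece pp fib hP hg hg0 hgB fun Z =>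
    condMeanGap_of_pairChannel (hP Z) hg (hmm Z) (hℓ Z) (fun U => by rw [abs_of_nonneg (hg0 U)]; exact hgB U)
      (hBm Z) (hBℓ Z) (hmI Z) (hp Z) (hq₁ Z) (hq₂ Z)

end Fibre

end Literature.MathematicalPhysics.QuantumFieldTheory.Balaban1983to89.T4CondMeanChannelInsert
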